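import Summits.ABC.IUTFork.Joshi.TensorNormsBidual
import Mathlib.Analysis.Normed.Lp.ProdLp
import Mathlib.Analysis.Normed.Group.Ultra
import HarnessLib

/-!
# Joshi's §7.6 (arXiv:2401.13508v4, Thm 7.6.2.2 (3)): the bidual («normed by its dual») hypothesis of
# `Joshi/TensorNormsBidual.lean` is REFUTABLE as typed over every `ℚ_p` — the reduction needs `IsUltrametricDist` on the spaces

Proof-only companion (abc-iut cell, branch E «type Joshi's construction, test vs S», rung LADDER-ABC:A2.E; seat abc-iut-E-t44,
T-44 test/discharge seat, RQ7-with-teeth on a sibling's landed file) of abc-iut-E-t14's `Joshi/TensorNormsBidual.lean`. TAKES NO SIDE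
on [IUTchIII] Cor. 3.12, on Joshi's claims (unrefereed preprint, bib `Joshi2024ATS3`) or on Mochizuki's report on them; nothing of
Joshi's is asserted or denied here — this file is about the shape of OUR reduction, and everything in it is classical functional
analysis ([folklore]).

WHAT `TensorNormsBidual` DOES: it reduces Joshi's p-adic cross-norm hypothesis `TensorNorm.CrossNormClaim p E` (Thm 7.6.2.2 (3)) to
the hypothesis «every Banach space `W` over `E` is normed by its dual in the operator-norm sense»,
`h : ∀ (W : Type w) [NormedAddCommGroup W] [NormedSpace E W], CompleteSpace W → ∀ x : W, ‖inclusionInDoubleDual E W x‖ = ‖x‖`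
(`crossNormClaim_of_bidual`, `crossNormSeminormedClaim_of_bidual`, `injectiveNorm_tprod_of_bidual_padic`), describing `h` as Ingleton's
non-archimedean Hahn–Banach theorem for spherically complete `E`.

WHAT THIS FILE SHOWS: as typed — quantifying over ALL Mathlib normed `E`-spaces, ultrametric or not — `h` is FALSE for `E = ℚ_p`,
every prime `p` (`not_bidual_hypothesis_padic`, also the completeness-free form `not_bidual_hypothesis_padic_seminormed`): the
two-dimensional space `W = ℚ_p × ℚ_p` with the `ℓ¹`-norm `‖(a, b)‖ = |a|_p + |b|_p` (Mathlib `WithLp 1 (ℚ_[p] × ℚ_[p])`, complete) and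
`x = (1, 1)` have `‖x‖ = 2` but `‖ι x‖ ≤ 1`: for every functional `g`, `|g(x)|_p = |g(1,0) + g(0,1)|_p ≤ max(|g(1,0)|_p, |g(0,1)|_p) ≤ ‖g‖`
by the ultrametric inequality IN `ℚ_p` (`norm_inclusionInDoubleDual_l1Diag_le`; «l1Diag» = the test vector `(1,1)`). So the three reductions of `TensorNormsBidual` are
VACUOUSLY TRUE as typed and cannot consume Ingleton's theorem when it lands (abc-iut-found, `Literature.Analysis.OperatorTheory`,
announced 06:50:16Z): Ingleton norms ULTRAMETRIC spaces (`[IsUltrametricDist W]`) over spherically complete fields, not all normed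
spaces — the same restriction abc-iut-found recommended for `CrossNormClaim` itself (STATUS 06:50:16Z (a), the `ℓ¹` example in prose;
here in kernel). REPAIR (for the author, one line each): add `[IsUltrametricDist W]` to the binder of `h` in the three reductions (and,
per abc-iut-found, `[∀ i, IsUltrametricDist (V i)]` to the claims) — Joshi's own spaces (`B_E` with `|−|_ρ`, finite extensions `E′_w`)
are ultrametric, so nothing of [J-III] is lost. No side taken; typed ≠ proved. [folklore]
-/

noncomputable section

namespace Summit.ABC.IUTFork.Joshi.TensorNorm

open NormedSpace

variable (p : ℕ) [Fact p.Prime]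

/-- `‖(1, 1)‖_{ℓ¹} = 2`. [folklore] -/
theorem norm_l1Diag : ‖(WithLp.toLp 1 ((1 : ℚ_[p]), (1 : ℚ_[p])) : WithLp 1 (ℚ_[p] × ℚ_[p]))‖ = 2 := by
  rw [WithLp.prod_norm_eq_of_L1]
  simp only [WithLp.toLp_fst, WithLp.toLp_snd, norm_one]
  norm_num

/-- `(1, 1) = (1, 0) + (0, 1)` in `WithLp 1 (ℚ_p × ℚ_p)`. [folklore] -/
theorem l1Diag_eq_add :
    (WithLp.toLp 1 ((1 : ℚ_[p]), (1 : ℚ_[p])) : WithLp 1 (ℚ_[p] × ℚ_[p])) = WithLp.toLp 1 ((1 : ℚ_[p]), (0 : ℚ_[p])) + WithLp.toLp 1 ((0 : ℚ_[p]), (1 : ℚ_[p])) := by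
  rw [← WithLp.toLp_add, Prod.mk_add_mk, add_zero, zero_add]

/-- The two coordinate vectors have `ℓ¹`-norm `1`. [folklore] -/
theorem norm_l1Basis :
    ‖(WithLp.toLp 1 ((1 : ℚ_[p]), (0 : ℚ_[p])) : WithLp 1 (ℚ_[p] × ℚ_[p]))‖ = 1 ∧
      ‖(WithLp.toLp 1 ((0 : ℚ_[p]), (1 : ℚ_[p])) : WithLp 1 (ℚ_[p] × ℚ_[p]))‖ = 1 := by
  constructor <;>
  · rw [WithLp.prod_norm_eq_of_L1]
    simp only [WithLp.toLp_fst, WithLp.toLp_snd, norm_one, norm_zero]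
    norm_num

/-- **The bidual norm of `(1, 1)` is at most `1`**: every functional `g` on `(ℚ_p², ℓ¹)` has `|g(1,1)|_p ≤ max(|g(1,0)|_p, |g(0,1)|_p) ≤ ‖g‖`
by the ultrametric inequality in `ℚ_p`. [folklore] -/
theorem norm_inclusionInDoubleDual_l1Diag_le :
    ‖inclusionInDoubleDual ℚ_[p] (WithLp 1 (ℚ_[p] × ℚ_[p])) (WithLp.toLp 1 ((1 : ℚ_[p]), (1 : ℚ_[p])) : WithLp 1 (ℚ_[p] × ℚ_[p]))‖ ≤ 1 := by
  refine ContinuousLinearMap.opNorm_le_bound _ zero_le_one fun g => ?_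
  rw [dual_def, one_mul, l1Diag_eq_add, map_add]
  obtain ⟨h1, h2⟩ := norm_l1Basis p
  refine (IsUltrametricDist.norm_add_le_max _ _).trans (max_le ?_ ?_)
  · simpa [h1] using g.le_opNorm (WithLp.toLp 1 ((1 : ℚ_[p]), (0 : ℚ_[p])))
  · simpa [h2] using g.le_opNorm (WithLp.toLp 1 ((0 : ℚ_[p]), (1 : ℚ_[p])))

/-- Hence `(ℚ_p², ℓ¹)` is NOT normed by its dual: `‖ι (1,1)‖ ≤ 1 < 2 = ‖(1,1)‖`. [folklore] -/
theorem norm_inclusionInDoubleDual_l1Diag_lt :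
    ‖inclusionInDoubleDual ℚ_[p] (WithLp 1 (ℚ_[p] × ℚ_[p])) (WithLp.toLp 1 ((1 : ℚ_[p]), (1 : ℚ_[p])) : WithLp 1 (ℚ_[p] × ℚ_[p]))‖ < ‖(WithLp.toLp 1 ((1 : ℚ_[p]), (1 : ℚ_[p])) : WithLp 1 (ℚ_[p] × ℚ_[p]))‖ := by
  rw [norm_l1Diag]
  exact (norm_inclusionInDoubleDual_l1Diag_le p).trans_lt one_lt_two

/-- **The bidual hypothesis of `TensorNormsBidual.crossNormClaim_of_bidual` / `injectiveNorm_tprod_of_bidual_padic` is FALSE at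
`E = ℚ_p` as typed** (all complete normed `ℚ_p`-spaces, no `IsUltrametricDist`): witness `W = WithLp 1 (ℚ_[p] × ℚ_[p])`, `x = (1,1)`.
So those reductions are vacuous until `[IsUltrametricDist W]` is added to the binder. [folklore] -/
theorem not_bidual_hypothesis_padic :
    ¬ ∀ (W : Type) [NormedAddCommGroup W] [NormedSpace ℚ_[p] W], CompleteSpace W →
        ∀ x : W, ‖inclusionInDoubleDual ℚ_[p] W x‖ = ‖x‖ := fun h =>
  (norm_inclusionInDoubleDual_l1Diag_lt p).ne
    (h (WithLp 1 (ℚ_[p] × ℚ_[p])) (FiniteDimensional.complete ℚ_[p] _) (WithLp.toLp 1 ((1 : ℚ_[p]), (1 : ℚ_[p])) : WithLp 1 (ℚ_[p] × ℚ_[p])))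

/-- The completeness-free form (hypothesis of `crossNormSeminormedClaim_of_bidual` at `E = ℚ_p`) is FALSE as typed too. [folklore] -/
theorem not_bidual_hypothesis_padic_seminormed :
    ¬ ∀ (W : Type) [SeminormedAddCommGroup W] [NormedSpace ℚ_[p] W],
        ∀ x : W, ‖inclusionInDoubleDual ℚ_[p] W x‖ = ‖x‖ := fun h =>
  (norm_inclusionInDoubleDual_l1Diag_lt p).ne (h (WithLp 1 (ℚ_[p] × ℚ_[p])) (WithLp.toLp 1 ((1 : ℚ_[p]), (1 : ℚ_[p])) : WithLp 1 (ℚ_[p] × ℚ_[p])))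

end Summit.ABC.IUTFork.Joshi.TensorNorm

end
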